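import Summits.ResolutionOfSingularities.ResolutionOfSingularities.Theorems.MarkedTransferCampaignW46TameMaximalContact
import Literature.AlgebraicGeometry.Resolution.KollarSurfaceOrderReductionTameLocal
import HarnessLib

/-!
# [OURS · L1 W4.6, rung (iv) «large characteristic» ∩ rung (i) «surfaces»] In regime (iv) the characteristic-zero
# order reduction TERMINATES LOCALLY at every surface point of every state of the TYPED procedure: the honest
# threshold for surfaces is the order `b` itself (cell res-hironaka, LADDER-RESOLUTION rung L, D-0089; slot W4.6,
# seat res-L1-s46-pv-7; host route MarkedTransfer, `--supports stmt-ResolutionOfSingularities-16155 --as helper`)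

HONEST FRAMING. Nothing here is a statement of H. Hironaka's manuscript (2017-03-23, [Hironaka2017]) and nothing here
asserts that any statement of it holds. OURS corollaries, over the shared typed-procedure module
`MarkedTransferCampaignW46TypedProcedure` (res-L1-type-o1: `CampaignW46.Regime.charGT`; the manuscript enters only
through the typed CANDIDATE carriers `AmbientDatum`, `IdealExponent`, `IdealExponent.sing`, used as definitions), of
the TREE's Kollár layer in its tame range, completed by this seat in dimension two:
`Literature/AlgebraicGeometry/Resolution/MarkedCurveOrderReduction.lean` (p542856: order reduction for marked ideals in
dimension ONE, every characteristic), `…/KollarSurfaceOrderReductionTame.lean` (p544168) and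
`…/KollarSurfaceOrderReductionTameLocal.lean` (local order reduction at every closed point of a surface for
`max-ord I ≤ b < p`). No premise of the manuscript, no FACT-LIST premise. AI review is weaker than expert review. No
`sorry`, no new definition; axioms standard.

## What this file pins («(iv) large p: the typed procedure terminates for p > C — the honest C», for surfaces)

Gen 5 of this seat showed that LEVEL 1 of the characteristic-zero induction (maximal contact, Kollár Thm. 3.80, and
going up, Cor. 3.85) is available at every state of the typed procedure in regime (iv) := `Regime.charGT n (fun _ b ↦ b)`
(«`p > b`»), and that the SECOND level needs `p >` (orders of the restricted coefficient ideal) `≥ b!`, unbounded in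
`b` in general (`CoefficientIdealWildExample.lean`). When the ambient `Z` is a SURFACE the second level is a CURVE,
where order reduction is characteristic-free; hence:

* `exists_isResolutionOf_nhd_of_charGT` — for a state `(A, E)`, `E = (J, b)`, over a PERFECT field `K` of
  characteristic `p`, in regime (iv), with `1 ≤ b` and `J` of maximal order `b` (`ord ≤ b` everywhere), EVERY CLOSED
  POINT `ξ ∈ Z` WITH `dim 𝒪_{Z,ξ} = 2` has an open neighbourhood `U` carrying a smooth blow-up sequence which RESOLVES
  the marked ideal `(U, J|_U, ∅, b)` in the sense of BGMW Def. 3.1.3 (tree `CentreSeq.IsResolutionOf`: regular centres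
  inside the successive order-`≥ b` loci = `Sing` of the successive controlled transforms — the transform law of the
  typed `IdealExponent.transform`, Def. 2.1 —, simple normal crossings with the exceptional boundary, and EMPTY final
  `Sing`). Instance of `Kollar2007.exists_isResolutionOf_nhd_of_closedPoint` at `X := Z`, `I := J`;
* `exists_isResolutionOf_nhd_of_le` — the same in every regime `Regime.charGT n f` with `(fun _ b ↦ b) ≤ f`;
* `exists_isResolutionOf_nhd_of_isolated_sing` / `…_of_sing_subset_singleton` — the two halves made explicit: at a
  closed surface point isolated in `Sing(E)` the resolving sequence is the push-forward of POINT blow-ups on a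
  maximal-contact curve (Kollár 3.104 Step 2.2); the complementary case (a curve of `Sing(E)` through `ξ`) is one
  blowing up of that curve (3.111 Step 1), see the Literature file.

So the HONEST `C` of the target «the typed procedure terminates for `p > C(n, d)`» is, for `n = dim Z = 2`, the order:
`C(2, ·) = b` — locally at every closed point, with Kollár's centres. What is NOT here: (a) the GLOBAL blow-up sequence
on `Z` (Kollár's globalisation 3.105 by functoriality is not ported to characteristic `p`; the local sequences at the
finitely many isolated points and along the curve components do not interact, but their assembly into one `CentreSeq Z`
is not written); (b) `dim Z ≥ 3`, where the second level is a surface and the threshold becomes the (unbounded) order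
of the coefficient ideal (gen 5, `MarkedTransferCampaignW46TameSecondLevel`).

## References (context; nothing is cited as a premise)

* J. Kollár, *Lectures on Resolution of Singularities* (2007), Thm. 3.69, 3.70, 3.104 Step 2.2, 3.111 Step 1,
  Thm. 3.80, Cor. 3.85 — through the tree's Kollár layer and this seat's Literature files. [cite: Kollar2007, Thm. 3.69]
* E. Bierstone, D. Grigoriev, P. Milman, J. Włodarczyk (2011), Def. 3.1.3, Thm. 8.0.4.
  [cite: BierstoneGrigorievMilmanWlodarczyk2011, Thm. 8.0.4]
* `Theorems/MarkedTransferCampaignW46TypedProcedure.lean` (DESIGN POINT (REG) (iv)); this seat's p471737, p527041.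
-/

noncomputable section

set_option linter.dupNamespace false -- mandated namespace of this single-conjunct summit

open CategoryTheory AlgebraicGeometry TopologicalSpace IsLocalRing

namespace Summit.ResolutionOfSingularities.ResolutionOfSingularities.Theorems
namespace CampaignW46
namespace TameSurfaceOrderReduction

open Literature.AlgebraicGeometry.Resolution
open Literature.AlgebraicGeometry.Hironaka2017.S02Preliminaries

universe u

variable {n : ℕ} {p : ℕ} [Fact p.Prime] {K : Type u} [Field K] [CharP K p]

/-- [OURS · L1 W4.6 (iv) ∩ (i); NOT a statement of the manuscript] **In regime (iv), at every closed surface point of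
every state of maximal order, the characteristic-zero order reduction terminates locally.** For `(A, E)`, `E = (J, b)`,
over a perfect field `K` of characteristic `p`, in `Regime.charGT n (fun _ b ↦ b)` (`b < p`), with `1 ≤ b` and
`ord_ξ J ≤ b` everywhere: every closed point `ξ ∈ Z` with `dim 𝒪_{Z,ξ} = 2` has an open `U ∋ ξ` and a smooth blow-up
sequence on `U` RESOLVING `(U, J|_U, ∅, b)` (`CentreSeq.IsResolutionOf`: admissible regular centres in the successive
order-`≥ b` loci, snc with the exceptional boundary, final order-`≥ b` locus empty). Instance of this seat's
`Kollar2007.exists_isResolutionOf_nhd_of_closedPoint` (Kollár 3.104 Step 2.2 + 3.111 Step 1, with order reduction on the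
maximal-contact CURVE in every characteristic) at `X := Z`, `I := J`, `b := E.b`. [cite: Kollar2007, Thm. 3.69] -/
theorem exists_isResolutionOf_nhd_of_charGT [PerfectField K] (A : AmbientDatum p K) (E : IdealExponent A.Z)
    (hE : Regime.charGT (p := p) (K := K) n (fun _ b => b) A E) (hb : 1 ≤ E.b)
    (hmax : ∀ ξ : A.Z, idealOrder E.J ξ ≤ E.b) (ξ : A.Z) (hξ : IsClosed ({ξ} : Set A.Z))
    (hdim : ringKrullDim (A.Z.presheaf.stalk ξ) = 2) :
    ∃ (U : A.Z.Opens) (_ : ξ ∈ U) (s : CentreSeq (U : Scheme.{u})),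
      s.IsResolutionOf ⟨E.J.comap U.ι, [], E.b⟩ := by
  letI : A.Z.Over (Spec (.of K)) := ⟨A.hom⟩
  haveI : Smooth (A.Z ↘ Spec (.of K)) := A.smooth
  have hbp : E.b < p := hE
  exact Kollar2007.exists_isResolutionOf_nhd_of_closedPoint K A.Z p E.J hb (Or.inr hbp) hmax ξ hξ hdim

/-- [OURS · L1 W4.6 (iv) ∩ (i)] The same in every large-characteristic regime `Regime.charGT n f` whose threshold
dominates the order, `(fun _ b ↦ b) ≤ f` (e.g. the prior's V5 threshold `fun _ b ↦ b !`), by `Regime.charGT_of_le`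
(p471737). [cite: Kollar2007, Thm. 3.69] -/
theorem exists_isResolutionOf_nhd_of_le [PerfectField K] {f : ℕ → ℕ → ℕ} (hf : (fun _ b : ℕ => b) ≤ f)
    (A : AmbientDatum p K) (E : IdealExponent A.Z) (hE : Regime.charGT (p := p) (K := K) n f A E) (hb : 1 ≤ E.b)
    (hmax : ∀ ξ : A.Z, idealOrder E.J ξ ≤ E.b) (ξ : A.Z) (hξ : IsClosed ({ξ} : Set A.Z))
    (hdim : ringKrullDim (A.Z.presheaf.stalk ξ) = 2) :
    ∃ (U : A.Z.Opens) (_ : ξ ∈ U) (s : CentreSeq (U : Scheme.{u})),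
      s.IsResolutionOf ⟨E.J.comap U.ι, [], E.b⟩ :=
  exists_isResolutionOf_nhd_of_charGT A E (Regime.charGT_of_le (fun b => hf n b) A E hE) hb hmax ξ hξ hdim

/-- [OURS · L1 W4.6 (iv) ∩ (i); NOT a statement of the manuscript] **The isolated-point half, with its mechanism.** At a
closed surface point `ξ` ISOLATED in `Sing(E)` (some open `V ∋ ξ` with `Sing(E) ∩ V ⊆ {ξ}`), in regime (iv) with `J`
of maximal order `b ≥ 1`: an open `U ∋ ξ` carries a resolving blow-up sequence — the push-forward (Kollár 3.30.3) of
the point blow-ups resolving the restricted coefficient marked ideal `(V(H), 𝒞(J|_U, b)|_{V(H)}, ∅, b!)` on a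
maximal-contact curve `V(H) ∋ ξ` (Kollár 3.104 Step 2.2; `Kollar2007.exists_isResolutionOf_nhd_of_isolated`).
[cite: Kollar2007, Thm. 3.69] -/
theorem exists_isResolutionOf_nhd_of_isolated_sing [PerfectField K] (A : AmbientDatum p K)
    (E : IdealExponent A.Z) (hE : Regime.charGT (p := p) (K := K) n (fun _ b => b) A E) (hb : 1 ≤ E.b)
    (hmax : ∀ ξ : A.Z, idealOrder E.J ξ ≤ E.b) (ξ : A.Z) (hξ : IsClosed ({ξ} : Set A.Z))
    (hdim : ringKrullDim (A.Z.presheaf.stalk ξ) = 2) (V : A.Z.Opens) (hξV : ξ ∈ V)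
    (hiso : E.sing ∩ (V : Set A.Z) ⊆ {ξ}) :
    ∃ (U : A.Z.Opens) (_ : ξ ∈ U) (s : CentreSeq (U : Scheme.{u})),
      s.IsResolutionOf ⟨E.J.comap U.ι, [], E.b⟩ := by
  letI : A.Z.Over (Spec (.of K)) := ⟨A.hom⟩
  haveI : Smooth (A.Z ↘ Spec (.of K)) := A.smooth
  have hbp : E.b < p := hE
  exact Kollar2007.exists_isResolutionOf_nhd_of_isolated K A.Z p E.J hb (Or.inr hbp) hmax ξ hξ hdim V hξV
    (by rw [← TameMaximalContact.sing_eq_support]; exact hiso)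

/-- [OURS · L1 W4.6 (iv) ∩ (i); NOT a statement of the manuscript] **When `Sing(E)` is a single closed surface point
`ξ`** (e.g. an isolated singular point of a surface-supported exponent), no restriction to a smaller open is needed
beforehand: an open `U ∋ ξ` carries a resolving blow-up sequence (`Kollar2007.exists_isResolutionOf_nhd_of_support_subset_singleton`).
[cite: Kollar2007, Thm. 3.69] -/
theorem exists_isResolutionOf_nhd_of_sing_subset_singleton [PerfectField K] (A : AmbientDatum p K)
    (E : IdealExponent A.Z) (hE : Regime.charGT (p := p) (K := K) n (fun _ b => b) A E) (hb : 1 ≤ E.b)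
    (hmax : ∀ ξ : A.Z, idealOrder E.J ξ ≤ E.b) (ξ : A.Z) (hξ : IsClosed ({ξ} : Set A.Z))
    (hdim : ringKrullDim (A.Z.presheaf.stalk ξ) = 2) (hsing : E.sing ⊆ {ξ}) :
    ∃ (U : A.Z.Opens) (_ : ξ ∈ U) (s : CentreSeq (U : Scheme.{u})),
      s.IsResolutionOf ⟨E.J.comap U.ι, [], E.b⟩ := by
  letI : A.Z.Over (Spec (.of K)) := ⟨A.hom⟩
  haveI : Smooth (A.Z ↘ Spec (.of K)) := A.smooth
  have hbp : E.b < p := hE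
  exact Kollar2007.exists_isResolutionOf_nhd_of_support_subset_singleton K A.Z p E.J hb (Or.inr hbp) hmax ξ hξ
    hdim (by rw [← TameMaximalContact.sing_eq_support]; exact hsing)

/-- [OURS · L1 W4.6 (iv) ∩ (i)] **The final `Sing` is empty**: unfolding of `CentreSeq.IsResolutionOf` for the
sequences produced above — the order-`≥ b` locus (`IdealExponent.sing` of the typed exponent `(J_r, b)` carried by the
last controlled transform) of the final transform is EMPTY, and every centre was regular, inside the current order-`≥ b`
locus, with simple normal crossings with the exceptional divisors created so far (BGMW Def. 3.1.3 (1)–(2), (6)).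
[cite: BierstoneGrigorievMilmanWlodarczyk2011, Def. 3.1.3] -/
theorem sing_transform_eq_empty {U : Scheme.{u}} {J : U.IdealSheafData} {b : ℕ} {s : CentreSeq U}
    (hs : s.IsResolutionOf ⟨J, [], b⟩) :
    s.IsAdmissibleFor ⟨J, [], b⟩ ∧
      (IdealExponent.sing ⟨(s.transformMarked ⟨J, [], b⟩).ideal, (s.transformMarked ⟨J, [], b⟩).mult⟩ :
        Set s.top) = ∅ :=
  ⟨hs.1, hs.2⟩

end TameSurfaceOrderReduction
end CampaignW46
end Summit.ResolutionOfSingularities.ResolutionOfSingularities.Theorems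

end
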